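import Mathlib
import Summits.Parity.BatemanHorn.Theorems.IsogenyRedeiSplitBlockJacobiSplitMassBound
import Summits.Parity.BatemanHorn.Theorems.IsogenyRedeiSplitBlockJacobiSmallCofactorMass
import Summits.Parity.BatemanHorn.Theorems.IsogenyRedeiSplitBlockJacobiSmallCofactorWindows
import HarnessLib

/-!
# The small-cofactor tail is peelable (stub `stub_smallCofactorTail`, line
`cofactor-root-discrepancy`, crux `SplitBlockJacobi`, stmt-Parity-11583)

For `θ ∈ (1/2, 1)` and `ε > 0` we produce `μ ∈ (0, 1)` such that, eventually in `x`,

  `|∑_{(Q,Q′) ∈ P_θ(x), QQ′ > x^{2−μ}} (Q|Q′) · (A_{QQ′}(x) − 4x/(QQ′))| ≤ ε x`,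

where `P_θ(x)` is the free pair set (primes `Q ≡ Q′ ≡ 1 (4)`, `x^θ < Q < Q′`, `QQ′ ≤ x² + 1`) and
`A_q(x) = #{1 ≤ t ≤ x : q ∣ t² + 1}`.

Proof. `|(Q|Q′)| ≤ 1` and `|A − 4x/q| ≤ A + 4x/q`, so the sum is at most `MASS + 4x · Σ 1/(QQ′)`.
* MASS `= Σ_t #{tail pairs dividing t² + 1}`. KEY REDUCTION (`not_dvd_of_tail_pair_dvd`): if
  `QQ′ ∣ t² + 1` with `QQ′ > x^{2−μ}`, the cofactor `m = (t²+1)/(QQ′)` is `< 2x^μ`, and every prime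
  `p ≤ x^θ` dividing `t² + 1` divides `m`; so `t² + 1` is coprime to
  `W = ∏_{2x^μ < p ≤ x^{1/40}} p`. Each `t` carries `≤ 25` tail pairs (`card_pairs_le_card_mul`,
  `card_bigFactors_le_five`). Hence MASS `≤ 25 · #{t ≤ x : (t²+1, W) = 1} ≤ 25 C₁ μ x` by the
  sieve bound of helper I (`exists_card_coprime_window_le`).
* `Σ_{tail} 1/(QQ′) ≤ 4μ + 68/log x` by the Mertens windows of helper II
  (`eventually_sum_inv_tail_pairs_le`).
With `μ = min(1/2, ε/(2(25C₁ + 16)))` the total is `≤ (ε/2)x + 272x/log x ≤ εx` eventually.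
-/

/- LOG (stub_smallCofactorTail, worker for line cofactor-root-discrepancy)
  proved : helper 1 work/stubs/SmallCofactorMass.lean (rc0)
             — exists_card_coprime_window_le (registered via stub-add)
           helper 2 work/stubs/SmallCofactorWindows.lean (rc0)
             — eventually_sum_inv_tail_pairs_le (registered via stub-add)
           this file (rc0 as combined scratch work/stubs/scratch_all.lean): key reduction,
             mass bound, stub assembly
  landed : helper 1 → Theorems/IsogenyRedeiSplitBlockJacobiSmallCofactorMass.lean p83426 ACCEPTED
           helper 2 → Theorems/IsogenyRedeiSplitBlockJacobiSmallCofactorWindows.lean p84170 SUBMITTED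
           this file → Theorems/IsogenyRedeiSplitBlockJacobiSmallCofactorTail.lean (p-id: see
             ledger ls --mine; submitted right after this edit)
  left   : nothing to prove; verdicts of p84170 and of this file pending farm build (> 1 h)
-/

noncomputable section

open Filter Finset

namespace Summit.Parity.BatemanHorn.Cruxes.SplitBlockJacobi.CofactorRootDiscrepancy

namespace SmallCofactor

open Summit.Parity.BatemanHorn.Cruxes.SplitBlockJacobi.SplitMassMiddlePrime

/-! ### The key reduction: a tail pair forces coprimality with the window -/

/-- **Key reduction.** If `QQ′ ∣ t² + 1` for primes `x^θ < Q < Q′` with `QQ′ > x^{2−μ}` and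
`t ≤ x`, `x ≥ 1`, then no prime `p` with `2x^μ < p ≤ x^θ` divides `t² + 1`: such a `p` is neither
`Q` nor `Q′`, so it divides the cofactor `m = (t² + 1)/(QQ′) < (x² + 1)/x^{2−μ} ≤ 2x^μ < p`. -/
theorem not_dvd_of_tail_pair_dvd {x t Q Q' p : ℕ} {θ μ : ℝ} (hx : 1 ≤ x) (htx : t ≤ x)
    (hQ : Q.Prime) (hQ' : Q'.Prime) (hQQ' : Q < Q') (hθQ : (x : ℝ) ^ θ < (Q : ℝ))
    (hbig : (x : ℝ) ^ (2 - μ) < ((Q * Q' : ℕ) : ℝ)) (hdvd : Q * Q' ∣ t ^ 2 + 1)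
    (hp : p.Prime) (hp1 : 2 * (x : ℝ) ^ μ < p) (hp2 : (p : ℝ) ≤ (x : ℝ) ^ θ) :
    ¬ p ∣ t ^ 2 + 1 := by
  intro hpt
  obtain ⟨m, hm⟩ := hdvd
  have hpQ : ¬ p ∣ Q := fun h => by
    have hpq := (Nat.prime_dvd_prime_iff_eq hp hQ).mp h
    subst hpq
    linarith
  have hpQ' : ¬ p ∣ Q' := fun h => by
    have hpq := (Nat.prime_dvd_prime_iff_eq hp hQ').mp h
    subst hpq
    have : (Q : ℝ) < p := by exact_mod_cast hQQ'
    linarith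
  have hpm : p ∣ m := by
    rw [hm] at hpt
    rcases (Nat.Prime.dvd_mul hp).mp hpt with h | h
    · rcases (Nat.Prime.dvd_mul hp).mp h with h' | h'
      · exact absurd h' hpQ
      · exact absurd h' hpQ'
    · exact h
  have hm0 : 0 < m := by
    rcases Nat.eq_zero_or_pos m with h0 | h0
    · rw [h0, mul_zero] at hm
      exact absurd hm (by positivity)
    · exact h0
  have hpm' : (p : ℝ) ≤ m := by exact_mod_cast Nat.le_of_dvd hm0 hpm
  -- the size of the cofactor: `m · x^{2−μ} < m · QQ′ = t² + 1 ≤ 2x² = 2x^μ · x^{2−μ}`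
  have hx0 : (0 : ℝ) < x := by exact_mod_cast hx
  have hx1 : (1 : ℝ) ≤ x := by exact_mod_cast hx
  have htx' : (t : ℝ) ≤ x := by exact_mod_cast htx
  have h1 : ((Q * Q' : ℕ) : ℝ) * m = (t : ℝ) ^ 2 + 1 := by exact_mod_cast hm.symm
  have h2 : (t : ℝ) ^ 2 + 1 ≤ 2 * (x : ℝ) ^ 2 := by nlinarith
  have h3 : (x : ℝ) ^ 2 = (x : ℝ) ^ μ * (x : ℝ) ^ (2 - μ) := by
    rw [← Real.rpow_add hx0, add_sub_cancel, Real.rpow_two]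
  have hpos : 0 < (x : ℝ) ^ (2 - μ) := Real.rpow_pos_of_pos hx0 _
  have hm1 : (0 : ℝ) < m := by exact_mod_cast hm0
  have hmlt : (m : ℝ) * (x : ℝ) ^ (2 - μ) < 2 * (x : ℝ) ^ μ * (x : ℝ) ^ (2 - μ) := by
    calc (m : ℝ) * (x : ℝ) ^ (2 - μ) < m * ((Q * Q' : ℕ) : ℝ) := mul_lt_mul_of_pos_left hbig hm1
      _ = (t : ℝ) ^ 2 + 1 := by rw [mul_comm]; exact h1
      _ ≤ 2 * (x : ℝ) ^ 2 := h2
      _ = 2 * (x : ℝ) ^ μ * (x : ℝ) ^ (2 - μ) := by rw [h3]; ring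
  have hmlt' : (m : ℝ) < 2 * (x : ℝ) ^ μ := lt_of_mul_lt_mul_right hmlt hpos.le
  linarith

/-- A tail pair dividing `t² + 1` makes `t² + 1` coprime to the window modulus
`W = ∏_{2x^μ < p ≤ x^{1/40}} p` (for `θ > 1/2`, `x ≥ 2`, `t ≤ x`; `x^{1/40} ≤ x^θ`). -/
theorem coprime_window_of_tail_pair_dvd {x t Q Q' : ℕ} {θ μ : ℝ} (hθ : 1 / 2 < θ) (hx : 2 ≤ x)
    (htx : t ≤ x) (hQ : Q.Prime) (hQ' : Q'.Prime) (hQQ' : Q < Q') (hθQ : (x : ℝ) ^ θ < (Q : ℝ))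
    (hbig : (x : ℝ) ^ (2 - μ) < ((Q * Q' : ℕ) : ℝ)) (hdvd : Q * Q' ∣ t ^ 2 + 1) :
    (t ^ 2 + 1).Coprime
      (∏ p ∈ Nat.primesLE ⌊(x : ℝ) ^ (1 / 40 : ℝ)⌋₊ \ Nat.primesLE ⌊2 * (x : ℝ) ^ μ⌋₊, p) := by
  refine Nat.Coprime.prod_right fun p hp => ?_
  rw [Finset.mem_sdiff, Nat.mem_primesLE, Nat.mem_primesLE] at hp
  obtain ⟨⟨hple, hpp⟩, hpnot⟩ := hp
  have hx1 : (1 : ℝ) ≤ x := by exact_mod_cast le_trans (by norm_num) hx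
  have hp1 : 2 * (x : ℝ) ^ μ < p := by
    have h : ¬ p ≤ ⌊2 * (x : ℝ) ^ μ⌋₊ := fun h => hpnot ⟨h, hpp⟩
    rw [not_le, Nat.floor_lt (by positivity)] at h
    exact h
  have hp2 : (p : ℝ) ≤ (x : ℝ) ^ θ := by
    have h1 : (p : ℝ) ≤ ⌊(x : ℝ) ^ (1 / 40 : ℝ)⌋₊ := by exact_mod_cast hple
    have h2 : (⌊(x : ℝ) ^ (1 / 40 : ℝ)⌋₊ : ℝ) ≤ (x : ℝ) ^ (1 / 40 : ℝ) :=
      Nat.floor_le (by positivity)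
    have h3 : (x : ℝ) ^ (1 / 40 : ℝ) ≤ (x : ℝ) ^ θ :=
      Real.rpow_le_rpow_of_exponent_le hx1 (by linarith)
    linarith
  exact ((Nat.Prime.coprime_iff_not_dvd hpp).mpr
    (not_dvd_of_tail_pair_dvd (le_trans (by norm_num) hx) htx hQ hQ' hQQ' hθQ hbig hdvd hpp hp1
      hp2)).symm

/-- Each `t ≤ x` carries at most `25` pairs `x^θ < Q < Q′` of primes with `QQ′ ∣ t² + 1`
(`x ≥ 2`, `θ > 1/2`: at most five prime factors of `t² + 1` exceed `x^θ`). -/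
theorem card_filter_pair_dvd_le {θ : ℝ} (hθ : 1 / 2 < θ) {x t : ℕ} (hx : 2 ≤ x)
    (ht : t ∈ Finset.Icc 1 x) (T : Finset (ℕ × ℕ))
    (hT : ∀ q ∈ T, q.1.Prime ∧ q.2.Prime ∧ (x : ℝ) ^ θ < (q.1 : ℝ) ∧ q.1 < q.2) :
    (T.filter (fun q : ℕ × ℕ => q.1 * q.2 ∣ t ^ 2 + 1)).card ≤ 25 := by
  have hsub : T.filter (fun q : ℕ × ℕ => q.1 * q.2 ∣ t ^ 2 + 1) ⊆
      ((t ^ 2 + 1).primeFactors ×ˢ (t ^ 2 + 1).primeFactors).filter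
        (fun q : ℕ × ℕ => (x : ℝ) ^ θ < (q.1 : ℝ) ∧ q.1 < q.2) := by
    intro q hq
    rw [Finset.mem_filter] at hq
    obtain ⟨hqT, hdvd⟩ := hq
    obtain ⟨hq1, hq2, hθq, hlt⟩ := hT q hqT
    rw [Finset.mem_filter, Finset.mem_product, Nat.mem_primeFactors, Nat.mem_primeFactors]
    exact ⟨⟨⟨hq1, (dvd_mul_right _ _).trans hdvd, by positivity⟩,
      ⟨hq2, (dvd_mul_left _ _).trans hdvd, by positivity⟩⟩, hθq, hlt⟩
  refine (Finset.card_le_card hsub).trans ((card_pairs_le_card_mul θ x t ht).trans ?_)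
  have h5 := card_bigFactors_le_five hθ hx ht
  have h5' : ((t ^ 2 + 1).primeFactors.filter (fun p : ℕ => (x : ℝ) ^ θ < p ∧ p ≤ x)).card ≤ 5 :=
    (Finset.card_le_card fun p hp => by
      rw [Finset.mem_filter] at hp ⊢
      exact ⟨hp.1, hp.2.1⟩).trans h5
  calc _ ≤ 5 * 5 := Nat.mul_le_mul h5' h5
    _ = 25 := rfl

/-- **The mass bound.** There is an absolute `C > 0` such that for `θ > 1/2` and `μ > 0`,
eventually in `x`: for every finite set `T` of prime pairs `(Q, Q′)` with `x^θ < Q < Q′` and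
`QQ′ > x^{2−μ}`, `∑_{T} #{1 ≤ t ≤ x : QQ′ ∣ t² + 1} ≤ C μ x`
(Fubini in `(t, (Q,Q′))`, `card_filter_pair_dvd_le`, `coprime_window_of_tail_pair_dvd`, and the
window sieve bound `exists_card_coprime_window_le` of helper I). -/
theorem exists_mass_le :
    ∃ C : ℝ, 0 < C ∧ ∀ θ : ℝ, 1 / 2 < θ → ∀ μ : ℝ, 0 < μ → ∀ᶠ x : ℕ in atTop,
      ∀ T : Finset (ℕ × ℕ),
        (∀ q ∈ T, q.1.Prime ∧ q.2.Prime ∧ (x : ℝ) ^ θ < (q.1 : ℝ) ∧ q.1 < q.2 ∧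
          (x : ℝ) ^ (2 - μ) < ((q.1 * q.2 : ℕ) : ℝ)) →
        ∑ q ∈ T, ((((Finset.Icc 1 x).filter (fun t : ℕ => q.1 * q.2 ∣ t ^ 2 + 1)).card : ℕ) : ℝ)
          ≤ C * μ * x := by
  obtain ⟨C₁, hC₁, h₁⟩ := exists_card_coprime_window_le
  refine ⟨25 * C₁, by positivity, fun θ hθ μ hμ => ?_⟩
  filter_upwards [h₁ μ hμ, eventually_ge_atTop 2] with x hx hx2 T hT
  -- Fubini in `(t, (Q, Q′))`
  have hswap : ∑ q ∈ T, ((Finset.Icc 1 x).filter (fun t : ℕ => q.1 * q.2 ∣ t ^ 2 + 1)).card =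
      ∑ t ∈ Finset.Icc 1 x, (T.filter (fun q : ℕ × ℕ => q.1 * q.2 ∣ t ^ 2 + 1)).card := by
    simp only [Finset.card_filter]
    exact Finset.sum_comm
  -- pointwise in `t`: at most `25` tail pairs, and none unless `(t² + 1, W) = 1`
  have hpt : ∀ t ∈ Finset.Icc 1 x, (T.filter (fun q : ℕ × ℕ => q.1 * q.2 ∣ t ^ 2 + 1)).card ≤
      25 * (if (t ^ 2 + 1).Coprime
        (∏ p ∈ Nat.primesLE ⌊(x : ℝ) ^ (1 / 40 : ℝ)⌋₊ \ Nat.primesLE ⌊2 * (x : ℝ) ^ μ⌋₊, p)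
        then 1 else 0) := by
    intro t ht
    split_ifs with hc
    · rw [mul_one]
      exact card_filter_pair_dvd_le hθ hx2 ht T fun q hq =>
        ⟨(hT q hq).1, (hT q hq).2.1, (hT q hq).2.2.1, (hT q hq).2.2.2.1⟩
    · rw [mul_zero, Nat.le_zero, Finset.card_eq_zero, Finset.filter_eq_empty_iff]
      intro q hq hdvd
      obtain ⟨hq1, hq2, hθq, hlt, hbig⟩ := hT q hq
      exact hc (coprime_window_of_tail_pair_dvd hθ hx2 (Finset.mem_Icc.mp ht).2 hq1 hq2 hlt hθq
        hbig hdvd)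
  -- the integer inequality `Σ_T A_{QQ′} ≤ 25 · #{t : (t²+1, W) = 1}`
  have hnat : ∑ q ∈ T, ((Finset.Icc 1 x).filter (fun t : ℕ => q.1 * q.2 ∣ t ^ 2 + 1)).card ≤
      25 * ((Finset.Icc 1 x).filter (fun t : ℕ => (t ^ 2 + 1).Coprime
        (∏ p ∈ Nat.primesLE ⌊(x : ℝ) ^ (1 / 40 : ℝ)⌋₊ \ Nat.primesLE ⌊2 * (x : ℝ) ^ μ⌋₊,
          p))).card := by
    rw [hswap, Finset.card_filter, Finset.mul_sum]
    exact Finset.sum_le_sum hpt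
  have hreal : ∑ q ∈ T, ((((Finset.Icc 1 x).filter (fun t : ℕ => q.1 * q.2 ∣ t ^ 2 + 1)).card :
      ℕ) : ℝ) ≤ 25 * ((((Finset.Icc 1 x).filter (fun t : ℕ => (t ^ 2 + 1).Coprime
        (∏ p ∈ Nat.primesLE ⌊(x : ℝ) ^ (1 / 40 : ℝ)⌋₊ \ Nat.primesLE ⌊2 * (x : ℝ) ^ μ⌋₊,
          p))).card : ℕ) : ℝ) := by
    have h := (Nat.cast_le (α := ℝ)).mpr hnat
    push_cast at h
    exact h
  calc _ ≤ _ := hreal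
    _ ≤ 25 * (C₁ * μ * x) := mul_le_mul_of_nonneg_left hx (by norm_num)
    _ = 25 * C₁ * μ * x := by ring

end SmallCofactor

/-! ### The stub -/

/-- **STUB `stub_smallCofactorTail` of line `cofactor-root-discrepancy` (PROVED):** for
`θ ∈ (1/2, 1)` and `ε > 0` there is `μ ∈ (0, 1)` (namely `min(1/2, ε/(2(C + 16)))` with `C` the
mass constant) such that eventually in `x` the `(Q|Q′)`-weighted root discrepancy over the tail
pairs `QQ′ > x^{2−μ}` of the free pair set is at most `εx` in absolute value: the sum is bounded
by `MASS + 4x Σ 1/(QQ′) ≤ Cμx + 4x(4μ + 68/log x) ≤ εx`. -/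
theorem stub_smallCofactorTail :
    ∀ θ : ℝ, 1 / 2 < θ → θ < 1 → ∀ ε : ℝ, 0 < ε → ∃ μ : ℝ, 0 < μ ∧ μ < 1 ∧
      ∀ᶠ x : ℕ in Filter.atTop,
        |∑ q ∈ ((Finset.range (x ^ 2 + 2) ×ˢ Finset.range (x ^ 2 + 2)).filter (fun q : ℕ × ℕ =>
            q.1.Prime ∧ q.2.Prime ∧ q.1 % 4 = 1 ∧ q.2 % 4 = 1 ∧ (x : ℝ) ^ θ < (q.1 : ℝ) ∧ q.1 < q.2 ∧
              q.1 * q.2 ≤ x ^ 2 + 1)).filter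
            (fun q : ℕ × ℕ => ¬ ((q.1 * q.2 : ℕ) : ℝ) ≤ (x : ℝ) ^ (2 - μ)),
          (jacobiSym (q.1 : ℤ) q.2 : ℝ) *
            (((((Finset.Icc 1 x).filter (fun t : ℕ => q.1 * q.2 ∣ t ^ 2 + 1)).card : ℕ) : ℝ) -
              4 * (x : ℝ) / ((q.1 * q.2 : ℕ) : ℝ))| ≤ ε * x := by
  intro θ hθ hθ1 ε hε
  obtain ⟨C, hC, hmass⟩ := SmallCofactor.exists_mass_le
  set μ : ℝ := min (1 / 2) (ε / (2 * (C + 16))) with hμdef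
  have hμ0 : 0 < μ := lt_min (by norm_num) (by positivity)
  have hμhalf : μ ≤ 1 / 2 := min_le_left _ _
  have hμ1 : μ < 1 := by linarith
  have hμε : (C + 16) * μ ≤ ε / 2 := by
    have h : μ ≤ ε / (2 * (C + 16)) := min_le_right _ _
    rw [le_div_iff₀ (by positivity)] at h
    linarith
  refine ⟨μ, hμ0, hμ1, ?_⟩
  have evA := hmass θ hθ μ hμ0
  have evB := eventually_sum_inv_tail_pairs_le θ μ hθ hθ1 hμ0.le hμhalf
  have evlog : ∀ᶠ x : ℕ in atTop, 544 / ε ≤ Real.log x :=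
    (Real.tendsto_log_atTop.comp tendsto_natCast_atTop_atTop).eventually_ge_atTop _
  filter_upwards [evA, evB, evlog] with x hA hB hlog
  set T := ((Finset.range (x ^ 2 + 2) ×ˢ Finset.range (x ^ 2 + 2)).filter (fun q : ℕ × ℕ =>
      q.1.Prime ∧ q.2.Prime ∧ q.1 % 4 = 1 ∧ q.2 % 4 = 1 ∧ (x : ℝ) ^ θ < (q.1 : ℝ) ∧ q.1 < q.2 ∧
        q.1 * q.2 ≤ x ^ 2 + 1)).filter
      (fun q : ℕ × ℕ => ¬ ((q.1 * q.2 : ℕ) : ℝ) ≤ (x : ℝ) ^ (2 - μ)) with hT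
  have hmem : ∀ q ∈ T, q.1.Prime ∧ q.2.Prime ∧ (x : ℝ) ^ θ < (q.1 : ℝ) ∧ q.1 < q.2 ∧
      q.1 * q.2 ≤ x ^ 2 + 1 ∧ (x : ℝ) ^ (2 - μ) < ((q.1 * q.2 : ℕ) : ℝ) := by
    intro q hq
    rw [hT, Finset.mem_filter, Finset.mem_filter] at hq
    obtain ⟨⟨-, hp1, hp2, -, -, hθq, hlt, hle⟩, hbig⟩ := hq
    exact ⟨hp1, hp2, hθq, hlt, hle, not_le.mp hbig⟩
  have hA' := hA T fun q hq =>
    ⟨(hmem q hq).1, (hmem q hq).2.1, (hmem q hq).2.2.1, (hmem q hq).2.2.2.1,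
      (hmem q hq).2.2.2.2.2⟩
  have hB' := hB T hmem
  have hlogx : 0 < Real.log x := by
    have : 0 < 544 / ε := by positivity
    linarith
  have hx0 : (0 : ℝ) ≤ x := Nat.cast_nonneg x
  have h544 : 544 ≤ ε * Real.log x := by
    rw [div_le_iff₀ hε] at hlog
    linarith
  calc |∑ q ∈ T, (jacobiSym (q.1 : ℤ) q.2 : ℝ) *
          (((((Finset.Icc 1 x).filter (fun t : ℕ => q.1 * q.2 ∣ t ^ 2 + 1)).card : ℕ) : ℝ) -
            4 * (x : ℝ) / ((q.1 * q.2 : ℕ) : ℝ))|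
      ≤ ∑ q ∈ T, |(jacobiSym (q.1 : ℤ) q.2 : ℝ) *
          (((((Finset.Icc 1 x).filter (fun t : ℕ => q.1 * q.2 ∣ t ^ 2 + 1)).card : ℕ) : ℝ) -
            4 * (x : ℝ) / ((q.1 * q.2 : ℕ) : ℝ))| := Finset.abs_sum_le_sum_abs _ _
    _ ≤ ∑ q ∈ T, (((((Finset.Icc 1 x).filter (fun t : ℕ => q.1 * q.2 ∣ t ^ 2 + 1)).card : ℕ) : ℝ)
          + 4 * (x : ℝ) * (((q.1 * q.2 : ℕ) : ℝ))⁻¹) := by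
        refine Finset.sum_le_sum fun q _ => ?_
        rw [abs_mul]
        have hJ : |(jacobiSym (q.1 : ℤ) q.2 : ℝ)| ≤ 1 := by
          rcases jacobiSym.trichotomy (q.1 : ℤ) q.2 with h | h | h <;> simp [h]
        have hAq : (0 : ℝ) ≤
            ((((Finset.Icc 1 x).filter (fun t : ℕ => q.1 * q.2 ∣ t ^ 2 + 1)).card : ℕ) : ℝ) :=
          Nat.cast_nonneg _
        have hEq : (0 : ℝ) ≤ 4 * (x : ℝ) / ((q.1 * q.2 : ℕ) : ℝ) := by positivity
        calc |(jacobiSym (q.1 : ℤ) q.2 : ℝ)| *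
              |((((Finset.Icc 1 x).filter (fun t : ℕ => q.1 * q.2 ∣ t ^ 2 + 1)).card : ℕ) : ℝ) -
                4 * (x : ℝ) / ((q.1 * q.2 : ℕ) : ℝ)|
            ≤ 1 * |((((Finset.Icc 1 x).filter (fun t : ℕ => q.1 * q.2 ∣ t ^ 2 + 1)).card : ℕ) :
                ℝ) - 4 * (x : ℝ) / ((q.1 * q.2 : ℕ) : ℝ)| :=
              mul_le_mul_of_nonneg_right hJ (abs_nonneg _)
          _ ≤ 1 * (|((((Finset.Icc 1 x).filter (fun t : ℕ => q.1 * q.2 ∣ t ^ 2 + 1)).card : ℕ) :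
                ℝ)| + |4 * (x : ℝ) / ((q.1 * q.2 : ℕ) : ℝ)|) :=
              mul_le_mul_of_nonneg_left (abs_sub _ _) zero_le_one
          _ = _ := by rw [one_mul, abs_of_nonneg hAq, abs_of_nonneg hEq, div_eq_mul_inv]
    _ = ∑ q ∈ T, ((((Finset.Icc 1 x).filter (fun t : ℕ => q.1 * q.2 ∣ t ^ 2 + 1)).card : ℕ) : ℝ)
          + 4 * (x : ℝ) * ∑ q ∈ T, (((q.1 * q.2 : ℕ) : ℝ))⁻¹ := by
        rw [Finset.sum_add_distrib, Finset.mul_sum]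
    _ ≤ C * μ * x + 4 * (x : ℝ) * (4 * μ + 68 / Real.log x) :=
        add_le_add hA' (mul_le_mul_of_nonneg_left hB' (by positivity))
    _ = (C + 16) * μ * x + 272 / Real.log x * x := by ring
    _ ≤ ε / 2 * x + ε / 2 * x := by
        refine add_le_add (mul_le_mul_of_nonneg_right hμε hx0)
          (mul_le_mul_of_nonneg_right ?_ hx0)
        rw [div_le_iff₀ hlogx]
        linarith
    _ = ε * x := by ring

end Summit.Parity.BatemanHorn.Cruxes.SplitBlockJacobi.CofactorRootDiscrepancy

end
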